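import Literature.MathematicalPhysics.QuantumLattice.HubbardModel
import Literature.MathematicalPhysics.QuantumLattice.HubbardLiebConfig
import Literature.MathematicalPhysics.QuantumLattice.HubbardSzSectorLadder
import Literature.MathematicalPhysics.QuantumLattice.HubbardOneParticleCost
import Literature.MathematicalPhysics.QuantumLattice.HubbardCommutatorBound
import Literature.MathematicalPhysics.QuantumLattice.PairCorrelations
import Literature.MathematicalPhysics.QuantumLattice.DWaveSourceProofs
import Summits.HubbardSuperconductivity.HubbardSuperconductivity.Theorems.WeakCouplingBCSWcbcsBcsConstructionDoubleCommutatorBound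
import Summits.HubbardSuperconductivity.HubbardSuperconductivity.Theorems.AposterioriCapRgSsbToEvenTorusLroSpinWalkStep
import HarnessLib

/-!
# Route `AposterioriCapRg` — crux `SsbToEvenTorusLro` (stmt-HubbardSuperconductivity-1315),
# line `number-projected-canonical-slope`, stub `stub_spinWalk`

**What is proved.** `stub_spinWalk`: for the SOURCED canonical torus operator `A = H + κ W_R`,
`H = hubbardTorus 2 L 1 U`, `W_R = R⁻⁴ Σ_a B_aᴴ B_a` the Kac block interaction
(`B_a = Σ_{u ∈ [0,R)²} P_{a+u}`, `P_y = localPair dWaveFormFactor L y`), every unit vector `χ` of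
the coordinate sector `(N↑, N↓) = (a, b)` and every target `n` with `ρ₀L² ≤ n`, `2n ≤ L²` admit
a unit vector `χ'` of `szSector (2n) 0` with
`Re⟨χ', Aχ'⟩ ≤ Re⟨χ, Aχ⟩ + C(1 + |κ|)(|a - n| + |b - n|)`, `C = (18(2 + |U|) + K_W(R))(1/ρ₀ + 2)`.

**Proof.** (1) Part 1 (`…SpinWalkStep.lean`, `sw_main`) walks one electron at a time, each step
costing `≤ K|Λ|/N_σ` (removal: `Σ_x ‖c_{xσ}χ‖² = N_σ`,
`Σ_x ⟨c_{xσ}χ, A c_{xσ}χ⟩ = N_σ⟨χ, Aχ⟩ + Σ_x ⟨c_{xσ}χ, [A, c_{xσ}]χ⟩`, and "some orbital does at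
least as well as the weighted average") resp. `≤ K|Λ|/(|Λ| - N_σ)` (addition), where
`K ≥ ‖[A, c^{(†)}_{xσ}]‖`. (2) Removals only happen at `N_σ > n ≥ ρ₀L²`, additions at
`N_σ < n ≤ L²/2`, so a step costs `≤ K/ρ₀` resp. `≤ 2K`. (3) `K = (K_H + K_W)(1 + |κ|)`:
`K_H = 18(2 + |U|)` from `HubbardCommutatorBound.lean` (degree `≤ 4`), and
`K_W(R) = R⁻⁴ · R²s · 2(R²K_d)²` (`s = #{0, ±e₁, ±e₂}`, `K_d = 2Σ_e|d(e)/√2|`) by GRADED LOCALITY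
(`sw_norm_commutator_sum_local_le`, the odd-observable twin of `dc_sum_norm_commutator_local_le`):
each `B_aᴴ B_a` is an even element of the CAR algebra of its one-step-thickened block
(`sw_blockPair_mem`), hence commutes with `c^{(†)}_{xσ}` unless the block is within one step of `x`,
which happens for `≤ R²s` blocks (`sw_card_filter_block_le`), each contributing
`≤ 2‖B_a‖² ≤ 2(R²K_d)²` (`sw_norm_blockPair_le`). As in
`WeakCouplingBCSWcbcsBcsConstructionDoubleCommutatorBound.lean`, torus lemmas with norms are stated
for an arbitrary `DecidableEq (FermionTorus 2 L)` instance and the proofs substitute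
`LinearOrder.toDecidableEq`, under which the generic CAR-subalgebra lemmas apply verbatim.

Sources: O. Bratteli, D. W. Robinson, *Operator Algebras and QSM II* (1997), §5.2.2 (graded
commutation); M. B. Hastings, T. Koma, CMP 265 (2006) 781, App. A (local decompositions, as in
`FermionLiebRobinson.lean`); H. Tasaki, *Physics and Mathematics of Quantum Many-Body Systems*
(2020), §2.1, §9.3; E. H. Lieb, PRL 62 (1989) 1201 (sectors); D. Ruelle, *Statistical Mechanics:
Rigorous Results* (1969), §3.4 (density-Lipschitz a priori bounds). [folklore]
-/

noncomputable section

namespace Summit.HubbardSuperconductivity.HubbardSuperconductivity.Theorems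

-- the problem namespace `…HubbardSuperconductivity.HubbardSuperconductivity…` is doubled by design
set_option linter.dupNamespace false

open Literature.MathematicalPhysics.QuantumLattice Literature.Probability.LatticeModels Matrix
open scoped Matrix ComplexOrder ComplexConjugate Matrix.Norms.L2Operator

/-! ### Graded locality against an odd observable -/

section Locality

variable {Λ : Type*} [LinearOrder Λ] [Fintype Λ]

/-- **Graded locality against an odd local observable**: if the `q_y` are EVEN and localised on the
site sets `V y`, with `‖q_y‖ ≤ M`, and `c` lies in the CAR algebra of the sites `X`, then
`‖[Σ_y q_y, c]‖ ≤ #{y : V y meets X} · 2M‖c‖` (even elements commute with everything localised in a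
disjoint region, Bratteli–Robinson II §5.2.2). [folklore] -/
theorem sw_norm_commutator_sum_local_le {κ : Type*} [Fintype κ] (V : κ → Finset Λ)
    (q : κ → Matrix (Finset (Orb Λ)) (Finset (Orb Λ)) ℂ)
    (hq : ∀ y, q y ∈ carEvenSubalgebra (orbSet (V y))) {M : ℝ} (hM : ∀ y, ‖q y‖ ≤ M)
    {X : Finset Λ} {c : Matrix (Finset (Orb Λ)) (Finset (Orb Λ)) ℂ}
    (hc : c ∈ carSubalgebra (orbSet X)) :
    ‖(∑ y, q y) * c - c * ∑ y, q y‖ ≤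
      (Finset.univ.filter fun y => ¬ Disjoint (V y) X).card * (2 * M * ‖c‖) := by
  -- adapted from `dc_sum_norm_commutator_local_le` (roles of the even / odd observables swapped)
  rw [finset_sum_commutator]
  refine (norm_sum_le _ _).trans ?_
  have hvanish : ∀ y, Disjoint (V y) X → q y * c - c * q y = 0 := fun y hy =>
    sub_eq_zero.mpr (commute_of_mem_carEvenSubalgebra (hq y) hc (disjoint_orbSet hy)).eq
  rw [← Finset.sum_filter_of_ne (p := fun y => ¬ Disjoint (V y) X)
    (fun y _ hne hdis => hne (by rw [hvanish y hdis, norm_zero]))]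
  calc ∑ y ∈ Finset.univ.filter (fun y => ¬ Disjoint (V y) X), ‖q y * c - c * q y‖
      ≤ ∑ _y ∈ Finset.univ.filter (fun y => ¬ Disjoint (V y) X), 2 * M * ‖c‖ :=
        Finset.sum_le_sum fun y _ => by
          calc ‖q y * c - c * q y‖ ≤ ‖q y * c‖ + ‖c * q y‖ := norm_sub_le _ _
            _ ≤ ‖q y‖ * ‖c‖ + ‖c‖ * ‖q y‖ := add_le_add (norm_mul_le _ _) (norm_mul_le _ _)
            _ = 2 * ‖q y‖ * ‖c‖ := by ring
            _ ≤ 2 * M * ‖c‖ := by gcongr; exact hM y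
    _ = _ := by rw [Finset.sum_const, nsmul_eq_mul]

end Locality

/-! ### The Kac block interaction on the torus -/

section Torus

variable (L : ℕ) [NeZero L] (R : ℕ)

/-- The sites of the Kac block `a + [0,R)²` thickened by one step: a finite set `V a` containing
every `a + u` and `a + u + e`, `u ∈ [0,R)²`, `e ∈ {0, ±e₁, ±e₂}`, and nothing else. [folklore] -/
theorem sw_exists_blockSupport : ∃ V : TorusSite 2 L → Finset (FermionTorus 2 L),
    (∀ (a : TorusSite 2 L) (u : Fin 2 → Fin R),
      FermionTorus.ofTorusSite (a + fun i => ((u i : ℕ) : ZMod L)) ∈ V a) ∧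
    (∀ (a : TorusSite 2 L) (u : Fin 2 → Fin R), ∀ e ∈ insert (0 : Site 2) unitSteps,
      FermionTorus.ofTorusSite ((a + fun i => ((u i : ℕ) : ZMod L)) + Torus.proj L e) ∈ V a) ∧
    (∀ (a : TorusSite 2 L) (w : FermionTorus 2 L), w ∈ V a → ∃ u : Fin 2 → Fin R,
      ∃ e ∈ insert (0 : Site 2) unitSteps,
        w = FermionTorus.ofTorusSite ((a + fun i => ((u i : ℕ) : ZMod L)) + Torus.proj L e)) := by
  have h0 : Torus.proj L (0 : Site 2) = 0 := funext fun i => by simp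
  refine ⟨fun a => Finset.univ.biUnion fun u : Fin 2 → Fin R =>
    (insert (0 : Site 2) unitSteps).image fun e =>
      FermionTorus.ofTorusSite ((a + fun i => ((u i : ℕ) : ZMod L)) + Torus.proj L e),
    fun a u => ?_, fun a u e he => ?_, fun a w hw => ?_⟩
  · exact Finset.mem_biUnion.2 ⟨u, Finset.mem_univ _,
      Finset.mem_image.2 ⟨0, Finset.mem_insert_self _ _, by rw [h0, add_zero]⟩⟩
  · exact Finset.mem_biUnion.2 ⟨u, Finset.mem_univ _, Finset.mem_image_of_mem _ he⟩
  · obtain ⟨u, -, hu⟩ := Finset.mem_biUnion.1 hw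
    obtain ⟨e, he, hwe⟩ := Finset.mem_image.1 hu
    exact ⟨u, e, he, hwe.symm⟩

/-- The Kac block pair operator `B_a = Σ_{u ∈ [0,R)²} P_{a+u}` and its adjoint are EVEN elements of
the CAR algebra of any set of sites containing all `a + u` and `a + u + e` (each `P_y` is a
combination of singlet bond pairs `c_{y↑}c_{y+e,↓} - c_{y↓}c_{y+e,↑}`). The local `DecidableEq`
instance makes the matrix-algebra instances of the torus reduce to the generic ones of
`carEvenSubalgebra`. [folklore] -/
theorem sw_blockPair_mem {V : Finset (FermionTorus 2 L)} (a : TorusSite 2 L)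
    (hyV : ∀ u : Fin 2 → Fin R, FermionTorus.ofTorusSite (a + fun i => ((u i : ℕ) : ZMod L)) ∈ V)
    (heV : ∀ (u : Fin 2 → Fin R), ∀ e ∈ insert (0 : Site 2) unitSteps,
      FermionTorus.ofTorusSite ((a + fun i => ((u i : ℕ) : ZMod L)) + Torus.proj L e) ∈ V) :
    (∑ u : Fin 2 → Fin R, localPair dWaveFormFactor L (a + fun i => ((u i : ℕ) : ZMod L))) ∈
        carEvenSubalgebra (orbSet V) ∧
      (∑ u : Fin 2 → Fin R, localPair dWaveFormFactor L (a + fun i => ((u i : ℕ) : ZMod L)))ᴴ ∈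
        carEvenSubalgebra (orbSet V) := by
  letI hdec : DecidableEq (FermionTorus 2 L) := LinearOrder.toDecidableEq
  constructor
  · refine Subalgebra.sum_mem _ fun u _ => ?_
    rw [Literature.Barriers.HubbardSuperconductivity.localPair_eq_sum_bondPair]
    exact Subalgebra.sum_mem _ fun e he =>
      Subalgebra.smul_mem _ (dc_bondPair_mem_carEvenSubalgebra (hyV u) (heV u e he)) _
  · rw [conjTranspose_sum]
    refine Subalgebra.sum_mem _ fun u _ => ?_
    rw [Literature.Barriers.HubbardSuperconductivity.localPair_eq_sum_bondPair, conjTranspose_sum]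
    refine Subalgebra.sum_mem _ fun e he => ?_
    rw [conjTranspose_smul]
    exact Subalgebra.smul_mem _
      (dc_bondPair_conjTranspose_mem_carEvenSubalgebra (hyV u) (heV u e he)) _

/-- `‖B_a‖ ≤ R² · 2Σ_e |d(e)/√2|` (`R²` local pairs, each a combination of bond pairs of norm
`≤ 2`). Stated for an arbitrary `DecidableEq (FermionTorus 2 L)` instance (on which the operator
norm depends syntactically); the proof substitutes the generic one. [folklore] -/
theorem sw_norm_blockPair_le [inst : DecidableEq (FermionTorus 2 L)] (a : TorusSite 2 L) :
    ‖∑ u : Fin 2 → Fin R, localPair dWaveFormFactor L (a + fun i => ((u i : ℕ) : ZMod L))‖ ≤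
      (R : ℝ) ^ 2 *
        (2 * ∑ e ∈ insert (0 : Site 2) unitSteps, |dWaveFormFactor e / Real.sqrt 2|) := by
  have hinst : inst = LinearOrder.toDecidableEq := Subsingleton.elim _ _
  subst hinst
  have hP : ∀ y : TorusSite 2 L, ‖localPair dWaveFormFactor L y‖ ≤
      2 * ∑ e ∈ insert (0 : Site 2) unitSteps, |dWaveFormFactor e / Real.sqrt 2| := fun y => by
    -- adapted from `norm_localPair_le` (DWaveSourceProofs.lean)
    rw [Literature.Barriers.HubbardSuperconductivity.localPair_eq_sum_bondPair, Finset.mul_sum]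
    refine (norm_sum_le _ _).trans (Finset.sum_le_sum fun e _ => ?_)
    rw [norm_smul, Complex.norm_real, Real.norm_eq_abs, mul_comm]
    exact mul_le_mul_of_nonneg_right
      (Literature.Barriers.HubbardSuperconductivity.norm_bondPair_le_two _ _) (abs_nonneg _)
  refine (norm_sum_le _ _).trans ?_
  calc ∑ u : Fin 2 → Fin R, ‖localPair dWaveFormFactor L (a + fun i => ((u i : ℕ) : ZMod L))‖
      ≤ ∑ _u : Fin 2 → Fin R,
          2 * ∑ e ∈ insert (0 : Site 2) unitSteps, |dWaveFormFactor e / Real.sqrt 2| :=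
        Finset.sum_le_sum fun u _ => hP _
    _ = _ := by
        rw [Finset.sum_const, Finset.card_univ, nsmul_eq_mul]
        simp

/-- Only the `≤ R² · #{0, ±e₁, ±e₂}` blocks `a = x - u - e` are within one step of the site `x`.
[folklore] -/
theorem sw_card_filter_block_le [DecidableEq (FermionTorus 2 L)]
    (V : TorusSite 2 L → Finset (FermionTorus 2 L))
    (hV : ∀ (a : TorusSite 2 L) (w : FermionTorus 2 L), w ∈ V a → ∃ u : Fin 2 → Fin R,
      ∃ e ∈ insert (0 : Site 2) unitSteps,
        w = FermionTorus.ofTorusSite ((a + fun i => ((u i : ℕ) : ZMod L)) + Torus.proj L e))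
    (x : FermionTorus 2 L) :
    (Finset.univ.filter fun a : TorusSite 2 L => ¬ Disjoint (V a) {x}).card ≤
      R ^ 2 * (insert (0 : Site 2) unitSteps).card := by
  set S : Finset (Site 2) := insert 0 unitSteps with hS_def
  refine (Finset.card_le_card (t := Finset.univ.biUnion fun u : Fin 2 → Fin R => S.image fun e =>
    FermionTorus.toTorusSite x - (fun i => ((u i : ℕ) : ZMod L)) - Torus.proj L e)
    fun a ha => ?_).trans ?_
  · rw [Finset.mem_filter] at ha
    obtain ⟨w, hwV, hwx⟩ := Finset.not_disjoint_iff.1 ha.2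
    rw [Finset.mem_singleton] at hwx
    obtain ⟨u, e, he, hwe⟩ := hV a w hwV
    refine Finset.mem_biUnion.2 ⟨u, Finset.mem_univ _, Finset.mem_image.2 ⟨e, he, ?_⟩⟩
    rw [← hwx, hwe, FermionTorus.toTorusSite_ofTorusSite]
    abel
  · calc (Finset.univ.biUnion fun u : Fin 2 → Fin R => S.image fun e =>
            FermionTorus.toTorusSite x - (fun i => ((u i : ℕ) : ZMod L)) - Torus.proj L e).card
        ≤ ∑ u : Fin 2 → Fin R, (S.image fun e =>
            FermionTorus.toTorusSite x - (fun i => ((u i : ℕ) : ZMod L)) - Torus.proj L e).card :=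
          Finset.card_biUnion_le
      _ ≤ ∑ _u : Fin 2 → Fin R, S.card := Finset.sum_le_sum fun u _ => Finset.card_image_le
      _ = R ^ 2 * S.card := by
          rw [Finset.sum_const, Finset.card_univ, smul_eq_mul]
          simp

/-- **Commutator of the sourced Hamiltonian `A = H + κ W_R` with a local fermion operator**: for `c`
in the CAR algebra of one site with `‖c‖ ≤ 1` and `‖[H, c]‖ ≤ K_H`,
`‖[A, c]‖ ≤ (K_H + K_W)(1 + |κ|)` with `K_W = R⁻⁴ · R² s · 2(R² K_d)²`, `s = #{0, ±e₁, ±e₂}`,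
`K_d = 2Σ_e |d(e)/√2|`: `W_R = R⁻⁴ Σ_a B_aᴴ B_a`, each `B_aᴴ B_a` is even and localised on its
thickened block, so only the `≤ R² s` blocks near the site fail to commute with `c` (graded
locality, Bratteli–Robinson II §5.2.2), each with `‖[B_aᴴ B_a, c]‖ ≤ 2‖B_a‖² ≤ 2(R² K_d)²`. Stated
for an arbitrary `DecidableEq (FermionTorus 2 L)` instance (the proof substitutes the generic one).
[folklore] -/
theorem sw_norm_commutator_sourced_le [inst : DecidableEq (FermionTorus 2 L)] (U κ : ℝ)
    (x : FermionTorus 2 L)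
    {c : Matrix (Finset (Orb (FermionTorus 2 L))) (Finset (Orb (FermionTorus 2 L))) ℂ}
    (hc : c ∈ carSubalgebra (orbSet ({x} : Finset (FermionTorus 2 L)))) (hc1 : ‖c‖ ≤ 1) {KH : ℝ}
    (hH : ‖hubbardTorus 2 L 1 U * c - c * hubbardTorus 2 L 1 U‖ ≤ KH) :
    ‖(hubbardTorus 2 L 1 U + (κ : ℂ) • (((((R : ℝ) ^ 4)⁻¹ : ℝ) : ℂ) • ∑ a : TorusSite 2 L,
        (∑ u : Fin 2 → Fin R, localPair dWaveFormFactor L (a + fun i => ((u i : ℕ) : ZMod L)))ᴴ *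
          (∑ u : Fin 2 → Fin R,
            localPair dWaveFormFactor L (a + fun i => ((u i : ℕ) : ZMod L))))) * c -
      c * (hubbardTorus 2 L 1 U + (κ : ℂ) • (((((R : ℝ) ^ 4)⁻¹ : ℝ) : ℂ) • ∑ a : TorusSite 2 L,
        (∑ u : Fin 2 → Fin R, localPair dWaveFormFactor L (a + fun i => ((u i : ℕ) : ZMod L)))ᴴ *
          (∑ u : Fin 2 → Fin R,
            localPair dWaveFormFactor L (a + fun i => ((u i : ℕ) : ZMod L)))))‖ ≤
      (KH + ((R : ℝ) ^ 4)⁻¹ * (((R ^ 2 * (insert (0 : Site 2) unitSteps).card : ℕ) : ℝ) *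
        (2 * ((R : ℝ) ^ 2 *
          (2 * ∑ e ∈ insert (0 : Site 2) unitSteps, |dWaveFormFactor e / Real.sqrt 2|)) ^ 2))) *
        (1 + |κ|) := by
  have hinst : inst = LinearOrder.toDecidableEq := Subsingleton.elim _ _
  subst hinst
  letI hdec : DecidableEq (FermionTorus 2 L) := LinearOrder.toDecidableEq
  set S : Finset (Site 2) := insert 0 unitSteps with hS_def
  set Kd : ℝ := 2 * ∑ e ∈ S, |dWaveFormFactor e / Real.sqrt 2| with hKd_def
  set KW : ℝ := ((R : ℝ) ^ 4)⁻¹ * (((R ^ 2 * S.card : ℕ) : ℝ) * (2 * ((R : ℝ) ^ 2 * Kd) ^ 2))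
    with hKW_def
  set H := hubbardTorus 2 L 1 U with hH_def
  set B : TorusSite 2 L →
      Matrix (Finset (Orb (FermionTorus 2 L))) (Finset (Orb (FermionTorus 2 L))) ℂ :=
    fun a => ∑ u : Fin 2 → Fin R, localPair dWaveFormFactor L (a + fun i => ((u i : ℕ) : ZMod L))
    with hB_def
  set Q : Matrix (Finset (Orb (FermionTorus 2 L))) (Finset (Orb (FermionTorus 2 L))) ℂ :=
    ∑ a : TorusSite 2 L, (B a)ᴴ * B a with hQ_def
  -- graded locality for the block interaction
  obtain ⟨V, hyV, heV, hVw⟩ := sw_exists_blockSupport L R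
  have hq : ∀ a, (B a)ᴴ * B a ∈ carEvenSubalgebra (orbSet (V a)) := fun a => by
    have h := sw_blockPair_mem L R a (hyV a) (heV a)
    exact Subalgebra.mul_mem _ h.2 h.1
  have hBn : ∀ a, ‖B a‖ ≤ (R : ℝ) ^ 2 * Kd := fun a => sw_norm_blockPair_le L R a
  have hM : ∀ a, ‖(B a)ᴴ * B a‖ ≤ ((R : ℝ) ^ 2 * Kd) ^ 2 := fun a => by
    calc ‖(B a)ᴴ * B a‖ ≤ ‖(B a)ᴴ‖ * ‖B a‖ := norm_mul_le _ _
      _ = ‖B a‖ * ‖B a‖ := by rw [l2_opNorm_conjTranspose]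
      _ ≤ ((R : ℝ) ^ 2 * Kd) * ((R : ℝ) ^ 2 * Kd) :=
          mul_le_mul (hBn a) (hBn a) (norm_nonneg _) (by positivity)
      _ = ((R : ℝ) ^ 2 * Kd) ^ 2 := by ring
  have key := sw_norm_commutator_sum_local_le V (fun a => (B a)ᴴ * B a) hq hM hc
  have hcount := sw_card_filter_block_le L R V hVw x
  have hr : (0 : ℝ) ≤ ((R : ℝ) ^ 4)⁻¹ := by positivity
  have hW : ‖((((((R : ℝ) ^ 4)⁻¹ : ℝ) : ℂ) • Q) * c -
      c * (((((R : ℝ) ^ 4)⁻¹ : ℝ) : ℂ) • Q))‖ ≤ KW := by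
    rw [smul_mul_assoc, mul_smul_comm, ← smul_sub, norm_smul, Complex.norm_real, Real.norm_eq_abs,
      abs_of_nonneg hr]
    refine mul_le_mul_of_nonneg_left (key.trans ?_) hr
    calc ((Finset.univ.filter fun a => ¬ Disjoint (V a) {x}).card : ℝ) *
          (2 * ((R : ℝ) ^ 2 * Kd) ^ 2 * ‖c‖)
        ≤ ((R ^ 2 * S.card : ℕ) : ℝ) * (2 * ((R : ℝ) ^ 2 * Kd) ^ 2 * 1) := by
          gcongr
      _ = _ := by rw [mul_one]
  -- assemble `[H + κW, c] = [H, c] + κ[W, c]`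
  have hKH : 0 ≤ KH := (norm_nonneg _).trans hH
  have hKW : 0 ≤ KW := (norm_nonneg _).trans hW
  have hsplit : (H + (κ : ℂ) • (((((R : ℝ) ^ 4)⁻¹ : ℝ) : ℂ) • Q)) * c -
      c * (H + (κ : ℂ) • (((((R : ℝ) ^ 4)⁻¹ : ℝ) : ℂ) • Q)) =
      (H * c - c * H) + (κ : ℂ) • ((((((R : ℝ) ^ 4)⁻¹ : ℝ) : ℂ) • Q) * c -
        c * (((((R : ℝ) ^ 4)⁻¹ : ℝ) : ℂ) • Q)) := by
    rw [add_mul, mul_add, smul_sub, smul_mul_assoc, mul_smul_comm]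
    abel
  rw [hsplit]
  calc ‖H * c - c * H + (κ : ℂ) • ((((((R : ℝ) ^ 4)⁻¹ : ℝ) : ℂ) • Q) * c -
          c * (((((R : ℝ) ^ 4)⁻¹ : ℝ) : ℂ) • Q))‖
      ≤ ‖H * c - c * H‖ + ‖(κ : ℂ) • ((((((R : ℝ) ^ 4)⁻¹ : ℝ) : ℂ) • Q) * c -
          c * (((((R : ℝ) ^ 4)⁻¹ : ℝ) : ℂ) • Q))‖ := norm_add_le _ _
    _ = ‖H * c - c * H‖ + |κ| * ‖(((((R : ℝ) ^ 4)⁻¹ : ℝ) : ℂ) • Q) * c -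
          c * (((((R : ℝ) ^ 4)⁻¹ : ℝ) : ℂ) • Q)‖ := by
        rw [norm_smul, Complex.norm_real, Real.norm_eq_abs]
    _ ≤ KH + |κ| * KW := by gcongr
    _ ≤ (KH + KW) * (1 + |κ|) := by nlinarith [abs_nonneg κ]

end Torus

/-! ### The stub -/

/-- **(WALK) stub_spinWalk** — the spin-resolved one-electron walk into the summit's sector. For every unit vector `χ`
of the coordinate sector `(N↑, N↓) = (a, b)` of the torus of side `L`, every target `n` with `ρ₀L² ≤ n`, `2n ≤ L²`, and
every coupling `κ`, there is a unit vector `χ'` of `szSector (2n) 0` with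
`Re⟨χ', (H + κW_R)χ'⟩ ≤ Re⟨χ, (H + κW_R)χ⟩ + C(1+|κ|)(|a − n| + |b − n|)`, `C = C(U, R, ρ₀)` volume-independent.
One step: `Σ_x ‖c_{xσ}χ‖² = N_σ`, `Σ_x c†_{xσ} A c_{xσ} = N_σ A + Σ_x c†_{xσ}[A, c_{xσ}]` (resp. the creation twin with
`L² − N_σ`), `‖[A, c_{xσ}]‖ ≤ K_H + |κ|K_W(R)` by graded locality, Cauchy–Schwarz, and "some orbital does at least as well
as the weighted average". PROVABLE NOW. [folklore] -/
theorem stub_spinWalk :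
    ∀ (U : ℝ) (R : ℕ), 0 < R → ∀ ρ₀ : ℝ, 0 < ρ₀ → ∃ C : ℝ, 0 ≤ C ∧
      ∀ (L : ℕ) [NeZero L] (κ : ℝ) (a b n : ℕ) (χ : Fock (Orb (FermionTorus 2 L))),
        ρ₀ * (L : ℝ) ^ 2 ≤ (n : ℝ) → 2 * n ≤ L ^ 2 → IsInSector a b χ → star χ ⬝ᵥ χ = 1 →
        ∃ χ' : Fock (Orb (FermionTorus 2 L)), χ' ∈ szSector (2 * n) 0 ∧ star χ' ⬝ᵥ χ' = 1 ∧
          (star χ' ⬝ᵥ (hubbardTorus 2 L 1 U + (κ : ℂ) • (((((R : ℝ) ^ 4)⁻¹ : ℝ) : ℂ) • ∑ a : TorusSite 2 L, (∑ u : Fin 2 → Fin R, localPair dWaveFormFactor L (a + fun i => ((u i : ℕ) : ZMod L)))ᴴ * (∑ u : Fin 2 → Fin R, localPair dWaveFormFactor L (a + fun i => ((u i : ℕ) : ZMod L))))) *ᵥ χ').re ≤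
            (star χ ⬝ᵥ (hubbardTorus 2 L 1 U + (κ : ℂ) • (((((R : ℝ) ^ 4)⁻¹ : ℝ) : ℂ) • ∑ a : TorusSite 2 L, (∑ u : Fin 2 → Fin R, localPair dWaveFormFactor L (a + fun i => ((u i : ℕ) : ZMod L)))ᴴ * (∑ u : Fin 2 → Fin R, localPair dWaveFormFactor L (a + fun i => ((u i : ℕ) : ZMod L))))) *ᵥ χ).re +
              C * (1 + |κ|) * (|(a : ℝ) - n| + |(b : ℝ) - n|) := by
  intro U R _hR ρ₀ hρ₀
  -- the constants: `K_H = 18(2 + |U|)`, `K_W(R)`, `K₀ = K_H + K_W`, `C = K₀ (1/ρ₀ + 2)`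
  set s : ℕ := (insert (0 : Site 2) unitSteps).card with hs_def
  set Kd : ℝ := 2 * ∑ e ∈ insert (0 : Site 2) unitSteps, |dWaveFormFactor e / Real.sqrt 2|
    with hKd_def
  set KW : ℝ := ((R : ℝ) ^ 4)⁻¹ * (((R ^ 2 * s : ℕ) : ℝ) * (2 * ((R : ℝ) ^ 2 * Kd) ^ 2))
    with hKW_def
  set K₀ : ℝ := 18 * (2 + |U|) + KW with hK₀_def
  have hK₀ : 0 ≤ K₀ := by positivity
  refine ⟨K₀ * (1 / ρ₀ + 2), by positivity, fun L _ κ a b n χ hρn h2n hχ hχ1 => ?_⟩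
  letI hdec : DecidableEq (FermionTorus 2 L) := LinearOrder.toDecidableEq
  have hK : 0 ≤ K₀ * (1 + |κ|) := by positivity
  -- `|Λ| = L²`
  have hcard : Fintype.card (FermionTorus 2 L) = L ^ 2 := by simp [FermionTorus, Fintype.card_lex]
  have hn : n ≤ Fintype.card (FermionTorus 2 L) := by rw [hcard]; omega
  -- the commutator bounds `‖[H + κW_R, c^{(†)}_{xσ}]‖ ≤ K₀ (1 + |κ|)`
  have hH : ∀ (v : FermionTorus 2 L) (σ : Fin 2),
      ‖hubbardTorus 2 L 1 U * annihilation (orb v σ) -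
          annihilation (orb v σ) * hubbardTorus 2 L 1 U‖ ≤ 18 * (2 + |U|) ∧
        ‖hubbardTorus 2 L 1 U * creation (orb v σ) - creation (orb v σ) * hubbardTorus 2 L 1 U‖ ≤
          18 * (2 + |U|) := by
    intro v σ
    have ha := norm_commutator_hamiltonianWith_annihilation_le (fermionTorusGraph 2 L) (Δ := 4)
      (fun y => SourceGas.card_filter_fermionTorusGraph_adj_le y) 1 U 0 v σ
    have hc := norm_commutator_hamiltonianWith_creation_le (fermionTorusGraph 2 L) (Δ := 4)
      (fun y => SourceGas.card_filter_fermionTorusGraph_adj_le y) 1 U 0 v σ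
    rw [hamiltonianWith_zero] at ha hc
    have h18 :
        ((2 * 4 + 1 : ℕ) : ℝ) * (2 * (2 * |(1 : ℝ)| + |U| + 2 * |(0 : ℝ)|)) = 18 * (2 + |U|) := by
      norm_num
      ring
    rw [h18] at ha hc
    exact ⟨ha, hc⟩
  have hKa : ∀ (σ : Fin 2) (v : FermionTorus 2 L), ‖(hubbardTorus 2 L 1 U + (κ : ℂ) •
      (((((R : ℝ) ^ 4)⁻¹ : ℝ) : ℂ) • ∑ a : TorusSite 2 L,
        (∑ u : Fin 2 → Fin R, localPair dWaveFormFactor L (a + fun i => ((u i : ℕ) : ZMod L)))ᴴ *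
          (∑ u : Fin 2 → Fin R, localPair dWaveFormFactor L (a + fun i => ((u i : ℕ) : ZMod L))))) *
        annihilation (orb v σ) - annihilation (orb v σ) * (hubbardTorus 2 L 1 U + (κ : ℂ) •
      (((((R : ℝ) ^ 4)⁻¹ : ℝ) : ℂ) • ∑ a : TorusSite 2 L,
        (∑ u : Fin 2 → Fin R, localPair dWaveFormFactor L (a + fun i => ((u i : ℕ) : ZMod L)))ᴴ *
          (∑ u : Fin 2 → Fin R,
            localPair dWaveFormFactor L (a + fun i => ((u i : ℕ) : ZMod L)))))‖ ≤
      K₀ * (1 + |κ|) := fun σ v =>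
    sw_norm_commutator_sourced_le L R U κ v
      (annihilation_mem_carSubalgebra (orb_mem_orbSet (Finset.mem_singleton_self v) σ))
      (norm_annihilation_le_one (ι := Orb (FermionTorus 2 L)) (orb v σ)) (hH v σ).1
  have hKc : ∀ (σ : Fin 2) (v : FermionTorus 2 L), ‖(hubbardTorus 2 L 1 U + (κ : ℂ) •
      (((((R : ℝ) ^ 4)⁻¹ : ℝ) : ℂ) • ∑ a : TorusSite 2 L,
        (∑ u : Fin 2 → Fin R, localPair dWaveFormFactor L (a + fun i => ((u i : ℕ) : ZMod L)))ᴴ *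
          (∑ u : Fin 2 → Fin R, localPair dWaveFormFactor L (a + fun i => ((u i : ℕ) : ZMod L))))) *
        creation (orb v σ) - creation (orb v σ) * (hubbardTorus 2 L 1 U + (κ : ℂ) •
      (((((R : ℝ) ^ 4)⁻¹ : ℝ) : ℂ) • ∑ a : TorusSite 2 L,
        (∑ u : Fin 2 → Fin R, localPair dWaveFormFactor L (a + fun i => ((u i : ℕ) : ZMod L)))ᴴ *
          (∑ u : Fin 2 → Fin R,
            localPair dWaveFormFactor L (a + fun i => ((u i : ℕ) : ZMod L)))))‖ ≤
      K₀ * (1 + |κ|) := fun σ v =>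
    sw_norm_commutator_sourced_le L R U κ v
      (creation_mem_carSubalgebra (orb_mem_orbSet (Finset.mem_singleton_self v) σ))
      (norm_creation_le_one (ι := Orb (FermionTorus 2 L)) (orb v σ)) (hH v σ).2
  -- the step costs: removals happen at `N_σ = m > n ≥ ρ₀L²`, additions at `N_σ = m < n ≤ L²/2`
  have hDa : ∀ m : ℕ, n < m →
      K₀ * (1 + |κ|) * Fintype.card (FermionTorus 2 L) / m ≤ K₀ * (1 / ρ₀ + 2) * (1 + |κ|) := by
    intro m hm
    rw [hcard]
    push_cast
    have hm0 : (0 : ℝ) < m := by exact_mod_cast (Nat.zero_le n).trans_lt hm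
    have hnm : (n : ℝ) ≤ m := by exact_mod_cast hm.le
    have hLm : (L : ℝ) ^ 2 ≤ m / ρ₀ := by
      rw [le_div_iff₀ hρ₀]
      linarith
    calc K₀ * (1 + |κ|) * (L : ℝ) ^ 2 / m ≤ K₀ * (1 + |κ|) * (m / ρ₀) / m := by gcongr
      _ = K₀ * (1 + |κ|) * (1 / ρ₀) := by field_simp
      _ ≤ K₀ * (1 / ρ₀ + 2) * (1 + |κ|) := by nlinarith
  have hDc : ∀ m : ℕ, m < n → K₀ * (1 + |κ|) * Fintype.card (FermionTorus 2 L) /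
      (Fintype.card (FermionTorus 2 L) - m) ≤ K₀ * (1 / ρ₀ + 2) * (1 + |κ|) := by
    intro m hm
    rw [hcard]
    push_cast
    have h2 : 2 * (m : ℝ) < (L : ℝ) ^ 2 := by exact_mod_cast (show 2 * m < L ^ 2 by omega)
    have hm0 : (0 : ℝ) ≤ m := Nat.cast_nonneg m
    have hpos : (0 : ℝ) < (L : ℝ) ^ 2 - m := by linarith
    rw [div_le_iff₀ hpos]
    have h3 : K₀ * (1 + |κ|) * (L : ℝ) ^ 2 ≤ 2 * (K₀ * (1 + |κ|)) * ((L : ℝ) ^ 2 - m) := by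
      nlinarith
    have h4 : 0 ≤ K₀ * (1 + |κ|) * (1 / ρ₀) * ((L : ℝ) ^ 2 - m) := by positivity
    nlinarith
  exact sw_main _ hKa hKc hDa hDc hn hχ hχ1

end Summit.HubbardSuperconductivity.HubbardSuperconductivity.Theorems

end
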